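import Literature.MathematicalPhysics.QuantumLattice.HubbardHighTemperatureAnalytic
import Mathlib.Analysis.Complex.TaylorSeries
import HarnessLib

/-!
# Term-by-term convergence of perturbation theory in the thermodynamic limit at high temperature

Companion of `HubbardHighTemperatureAnalytic.lean`: there, for real `0 ≤ β ≤ β₁ = SourceGasC.betaHTc`
and real `μ`, the finite-volume two-point functions `U ↦ twoPtTorusC β U μ L y σ` (holomorphic on the
strip `|β Im U| < π/3`) converge UNIFORMLY on the strip to the holomorphic thermodynamic limit
`htTwoPointLimitC β μ σ y`. By Weierstrass' theorem on locally uniform limits of holomorphic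
functions (Mathlib's `TendstoLocallyUniformlyOn.deriv`, iterated) all `U`-derivatives converge as
well, locally uniformly on the strip:

* `tendstoLocallyUniformlyOn_iteratedDeriv_twoPtTorusC` — for every `k`,
  `∂_U^k twoPt_L → ∂_U^k S` locally uniformly on the strip;
* `tendsto_iteratedDeriv_twoPtTorusC` — pointwise on the strip, in particular at `U = 0`
  (`tendsto_taylorCoeff_zero`): **the `k`-th Taylor coefficient at `U = 0` of the infinite-volume
  two-point function is the limit of the `k`-th finite-volume perturbative coefficients** — at high
  temperature, naive perturbation theory in `U` is correct term by term (and convergent,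
  `hasFPowerSeriesOnBall_htTwoPointLimitC`) in the thermodynamic limit.

A generic lemma `tendstoLocallyUniformlyOn_iteratedDeriv` (locally uniform convergence of all
iterated derivatives of a locally uniformly convergent sequence of holomorphic functions on an open
set) is proved first. No definition, no named fact.

## References

* D. Ueltschi, J. Stat. Phys. 95 (1999) 693, Thm. 2.1 (i)–(ii). [Ueltschi1999]
* G. Benfatto, A. Giuliani, V. Mastropietro, Ann. Henri Poincaré 7 (2006) 809, §1.3 and §2.1
  ("the usual formal power series in U … for the Schwinger functions"). [BenfattoGiulianiMastropietro2006]
-/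

noncomputable section

namespace Literature.MathematicalPhysics.QuantumLattice

open Filter SourceGas Literature.Probability.LatticeModels
open scoped _root_.Topology

/-! ### Weierstrass: iterated derivatives of locally uniform limits of holomorphic functions -/

/-- **Locally uniform convergence of all iterated derivatives** of a sequence of holomorphic
functions converging locally uniformly on an open set (Weierstrass; Mathlib's
`TendstoLocallyUniformlyOn.deriv`, iterated). [folklore] -/
theorem tendstoLocallyUniformlyOn_iteratedDeriv {ι : Type*} {φ : Filter ι} {F : ι → ℂ → ℂ} {f : ℂ → ℂ} {s : Set ℂ}
    (hf : TendstoLocallyUniformlyOn F f φ s) (hF : ∀ᶠ n in φ, DifferentiableOn ℂ (F n) s) (hs : IsOpen s) (k : ℕ) :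
    TendstoLocallyUniformlyOn (fun n => iteratedDeriv k (F n)) (iteratedDeriv k f) φ s := by
  induction k generalizing F f with
  | zero => simpa using hf
  | succ k ih =>
    have hd : TendstoLocallyUniformlyOn (deriv ∘ F) (deriv f) φ s := hf.deriv hF hs
    have hFd : ∀ᶠ n in φ, DifferentiableOn ℂ ((deriv ∘ F) n) s := by
      filter_upwards [hF] with n hn
      exact ((hn.analyticOnNhd hs).deriv).differentiableOn
    have h := ih hd hFd
    simp only [iteratedDeriv_succ']
    exact h

namespace SourceGasC

variable {β : ℝ}

/-- Locally uniform convergence of the finite-volume two-point functions on the strip. [cite: Ueltschi1999, Thm. 2.1 (ii)] -/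
theorem tendstoLocallyUniformlyOn_twoPtTorusC (hβ0 : 0 ≤ β) (hβ : β ≤ betaHTc) (μ : ℝ) (σ : Fin 2) (y : Site 2) :
    TendstoLocallyUniformlyOn (fun (L : ℕ) (U : ℂ) => twoPtTorusC β U (μ : ℂ) L y σ) (htTwoPointLimitC β μ σ y) atTop (strip β) :=
  (tendstoUniformlyOn_twoPtTorusC hβ0 hβ μ σ y).tendstoLocallyUniformlyOn

/-- **All `U`-derivatives converge in the thermodynamic limit**, locally uniformly on the strip.
[cite: Ueltschi1999, Thm. 2.1 (i)–(ii)] -/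
theorem tendstoLocallyUniformlyOn_iteratedDeriv_twoPtTorusC (hβ0 : 0 ≤ β) (hβ : β ≤ betaHTc) (μ : ℝ) (σ : Fin 2) (y : Site 2) (k : ℕ) :
    TendstoLocallyUniformlyOn (fun (L : ℕ) => iteratedDeriv k (fun U : ℂ => twoPtTorusC β U (μ : ℂ) L y σ))
      (iteratedDeriv k (htTwoPointLimitC β μ σ y)) atTop (strip β) :=
  tendstoLocallyUniformlyOn_iteratedDeriv (tendstoLocallyUniformlyOn_twoPtTorusC hβ0 hβ μ σ y)
    (Filter.Eventually.of_forall fun L => differentiableOn_twoPtTorusC hβ0 hβ μ L y σ) (isOpen_strip β) k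

/-- Pointwise on the strip: `∂_U^k twoPt_L(U) → ∂_U^k S(U)`. [cite: Ueltschi1999, Thm. 2.1 (i)–(ii)] -/
theorem tendsto_iteratedDeriv_twoPtTorusC (hβ0 : 0 ≤ β) (hβ : β ≤ betaHTc) (μ : ℝ) (σ : Fin 2) (y : Site 2) (k : ℕ)
    {U : ℂ} (hU : U ∈ strip β) :
    Tendsto (fun L : ℕ => iteratedDeriv k (fun U : ℂ => twoPtTorusC β U (μ : ℂ) L y σ) U) atTop
      (𝓝 (iteratedDeriv k (htTwoPointLimitC β μ σ y) U)) :=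
  (tendstoLocallyUniformlyOn_iteratedDeriv_twoPtTorusC hβ0 hβ μ σ y k).tendsto_at hU

/-- `0` lies in the strip. [folklore] -/
theorem zero_mem_strip (β : ℝ) : (0 : ℂ) ∈ strip β := by
  have h := ofReal_mem_strip β 0
  rwa [Complex.ofReal_zero] at h

/-- **Term-by-term convergence of perturbation theory at `U = 0`**: for every order `k`, the `k`-th
Taylor coefficient `∂_U^k S(0)/k!` of the infinite-volume two-point function is the limit of the
finite-volume perturbative coefficients `∂_U^k twoPt_L(0)/k!`. [cite: BenfattoGiulianiMastropietro2006, §2.1 ("the usual formal power series in U")] -/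
theorem tendsto_taylorCoeff_zero (hβ0 : 0 ≤ β) (hβ : β ≤ betaHTc) (μ : ℝ) (σ : Fin 2) (y : Site 2) (k : ℕ) :
    Tendsto (fun L : ℕ => iteratedDeriv k (fun U : ℂ => twoPtTorusC β U (μ : ℂ) L y σ) 0 / (k.factorial : ℂ)) atTop
      (𝓝 (iteratedDeriv k (htTwoPointLimitC β μ σ y) 0 / (k.factorial : ℂ))) :=
  (tendsto_iteratedDeriv_twoPtTorusC hβ0 hβ μ σ y k (zero_mem_strip β)).div_const _

/-- And the Taylor series with these coefficients converges to the infinite-volume two-point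
function on `|U| < π/(3β)` (`β > 0`): `S(U) = Σ_k (∂_U^k S(0)/k!) U^k`.
[cite: BenfattoGiulianiMastropietro2006, §1.3 (radius of convergence of the naive expansion)] -/
theorem hasSum_taylorSeries_htTwoPointLimitC (hβ0 : 0 < β) (hβ : β ≤ betaHTc) (μ : ℝ) (σ : Fin 2) (y : Site 2)
    {U : ℂ} (hU : ‖U‖ < Real.pi / 3 / β) :
    HasSum (fun k : ℕ => (k.factorial : ℂ)⁻¹ • U ^ k • iteratedDeriv k (htTwoPointLimitC β μ σ y) 0)
      (htTwoPointLimitC β μ σ y U) := by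
  have hd : DifferentiableOn ℂ (htTwoPointLimitC β μ σ y) (Metric.ball 0 (Real.pi / 3 / β)) :=
    (differentiableOn_htTwoPointLimitC hβ0.le hβ μ σ y).mono (ball_subset_strip hβ0)
  have hz : U ∈ Metric.ball (0 : ℂ) (Real.pi / 3 / β) := by rwa [Metric.mem_ball, dist_zero_right]
  have h := Complex.hasSum_taylorSeries_on_ball hd hz
  simpa only [sub_zero] using h

end SourceGasC

end Literature.MathematicalPhysics.QuantumLattice

end
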